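import Summits.AnomalousDissipation.AnomalousDissipation.Theses.SteadyMirrorGate
import Summits.AnomalousDissipation.AnomalousDissipation.Theses.PumpSignGate
import Summits.AnomalousDissipation.AnomalousDissipation.Theorems.TaylorGreenLoudGalerkinStates.Negative.Anatomy
import Literature.Analysis.FluidPDE.SteadyNavierStokesEnergy
import Literature.Analysis.FluidPDE.SteadyGalerkinApprox
import Literature.Analysis.FluidPDE.SteadyNavierStokesProofs
import Literature.Analysis.FluidPDE.NSGalerkinStationary
import Literature.Analysis.FluidPDE.NSHopfLimit
import Literature.Analysis.FluidPDE.EnergySpaceRellich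
import Literature.Analysis.FunctionSpaces.TorusSobolevNorm
import Literature.Analysis.FunctionSpaces.TorusAxisAverage
import Summits.AnomalousDissipation.AnomalousDissipation.Theorems.EnsembleRigidityGPMeanBoundedFamilyStubSymmetricScheme

/-!
# Routes SteadyMirrorGate / PumpSignGate — support `MirrorSteadyExistenceTG` (stmt-AnomalousDissipation-28078): part 1 of 3

Part 1 of the lens-6 g57 kernel K4 (see the TREE LANDING NOTE in `SteadyMirrorGateMirrorSteadyExistenceTG.lean`): §1 signed coordinate
permutations `(Qk)_j = ε_j k_{σ j}` and the affine maps they induce on Fourier data / Galerkin fields; §2 stationary Galerkin solutions in an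
invariant subspace (Temam 1979, Ch. II §1, Thm. 1.2 (i)). Namespace `…Theorems.MirrorSteadyExistence`; declarations byte-identical to K4
except that five §1 lemmas (`freqNormSq_signedPerm`, `galerkinField_signedPerm`, `mFourierCoeff_comp_affine`, `mFourierCoeff_of_symmetric`,
`symmetric_of_mFourierCoeff`) are REUSED from the tree module `EnsembleRigidityGPMeanBoundedFamilyStubSymmetricScheme` (gate `dedup.landed`:
identical statements; that namespace is opened inside `MirrorSteadyExistence` in all three parts).
[cite: Temam1979, Ch. II Thm. 1.2] [folklore]
-/

noncomputable section

-- every `Summit.AnomalousDissipation.AnomalousDissipation.…` name repeats the summit = sub-problem segment (D-0017 layout)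
set_option linter.dupNamespace false

namespace Summit.AnomalousDissipation.AnomalousDissipation.Theorems

open MeasureTheory Filter Topology Set UnitAddTorus
open scoped ENNReal NNReal InnerProductSpace
open Literature.Analysis.FunctionSpaces Literature.Analysis.FluidPDE

namespace MirrorSteadyExistence

-- §1 symmetry engine shared with the tree module `EnsembleRigidityGPMeanBoundedFamilyStubSymmetricScheme` (census g17 dedup, see part 1)
open Summit.AnomalousDissipation.AnomalousDissipation.Theorems.EnsembleRigidity.GPMeanBoundedFamily.StubSymmetricScheme

/-! ## §1 Signed coordinate permutations `(Qk)_j = ε_j k_{σ j}` and the affine maps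
`A y = (ε_j y_{σ j} + b_j)_j`: Fourier side (verbatim `StubSymmetricScheme`) -/

section Symmetry

variable {d : Type*} [Fintype d] (σ : Equiv.Perm d) {ε : d → ℤ} {Q : (d → ℤ) → (d → ℤ)}
  (hε : ∀ j, ε j = 1 ∨ ε j = -1) (hQ : ∀ k j, Q k j = ε j * k (σ j))

include hε hQ

/-- `Qk = 0 ↔ k = 0` (`Q` preserves `|k|²`). [folklore] -/
theorem signedPerm_eq_zero_iff (k : d → ℤ) : Q k = 0 ↔ k = 0 := by
  rw [← Torus.freqNormSq_eq_zero_iff, freqNormSq_signedPerm σ hε hQ, Torus.freqNormSq_eq_zero_iff]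

omit hQ in
/-- **The affine map `A y = (ε_j y_{σ j} + b_j)_j` preserves the Haar measure of `T^d`** (coordinate
permutation, reflections `ε_j = ±1`, translation). [folklore] -/
theorem measurePreserving_affine (b : UnitAddTorus d) :
    MeasurePreserving (fun y : UnitAddTorus d => fun j => ε j • y (σ j) + b j) volume volume := by
  have h1 : MeasurePreserving (⇑(MeasurableEquiv.piCongrLeft (fun _ : d => UnitAddCircle) σ.symm) :
      UnitAddTorus d → UnitAddTorus d) volume volume :=
    volume_measurePreserving_piCongrLeft (fun _ : d => UnitAddCircle) σ.symm
  rw [show (⇑(MeasurableEquiv.piCongrLeft (fun _ : d => UnitAddCircle) σ.symm) :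
      UnitAddTorus d → UnitAddTorus d) = fun y j => y (σ j) by
    funext y j; simp [MeasurableEquiv.coe_piCongrLeft, Equiv.piCongrLeft_apply_eq_cast]] at h1
  have hj : ∀ j, MeasurePreserving (fun x : UnitAddCircle => ε j • x) volume volume := fun j => by
    rcases hε j with h | h
    · simp only [h, one_zsmul]; exact MeasurePreserving.id volume
    · simp only [h, neg_one_zsmul]; exact Measure.measurePreserving_neg volume
  exact ((measurePreserving_add_right volume b).comp (volume_preserving_pi hj)).comp h1

end Symmetry

/-! ## §2 Stationary Galerkin solutions in an invariant subspace (Temam 1979, Ch. II §1, Thm. 1.2 (i),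
Lemma 1.4; verbatim the tree's `exists_galerkinRHS_eq_zero`, run in `W`) -/

section Stationary

open Literature.Analysis.FunctionSpaces.Torus Literature.Analysis.FluidPDE.Torus

variable {d : Type*} [Fintype d] [DecidableEq d] {S : Finset (d → ℤ)}

/-- **Existence of stationary Galerkin solutions in an invariant subspace**: for `ν > 0`, a symmetric
`S` not containing the mean mode, real force coefficients `g`, and a subspace `W` of the Galerkin phase space
mapped into itself by the Galerkin field, the field has a zero in `W` (acute angle lemma
`Brouwer.exists_zero_of_bilin_coercive` for the `ℓ²` form on `W`; coercivity from the energy identity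
`sum_re_inner_galerkinRHS_self` exactly as in `exists_galerkinRHS_eq_zero`).
[cite: Temam1979, Ch. II Thm. 1.2 (proof (i)), Lemma 1.4] -/
theorem exists_galerkinRHS_eq_zero_of_invariant {ν : ℝ} (hν : 0 < ν) (hS : ∀ k ∈ S, -k ∈ S)
    (hS0 : (0 : d → ℤ) ∉ S) {g : ↥S → EuclideanSpace ℂ d} (hg : IsRealCoeff g)
    (W : Submodule ℝ (↥S → EuclideanSpace ℂ d)) (hWle : W ≤ galerkinSubspace S)
    (hWinv : ∀ c ∈ W, galerkinRHS S ν g c ∈ W) :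
    ∃ c ∈ W, galerkinRHS S ν g c = 0 := by
  set Y := W with hY
  -- real scalars act on `ℂ^d` through the coercion `ℝ → ℂ`
  have hsmul : ∀ (a : ℝ) (x : EuclideanSpace ℂ d), a • x = (a : ℂ) • x := fun a x => by
    ext i
    simp only [PiLp.smul_apply, Complex.real_smul, smul_eq_mul]
  -- the `ℓ²` bilinear form on coefficient vectors, restricted to `Y`
  obtain ⟨B₀, hB₀⟩ : ∃ B₀ : (↥S → EuclideanSpace ℂ d) →ₗ[ℝ] (↥S → EuclideanSpace ℂ d) →ₗ[ℝ] ℝ,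
      ∀ c c', B₀ c c' = ∑ k : ↥S, (inner ℂ (c k) (c' k)).re :=
    ⟨LinearMap.mk₂ ℝ (fun c c' => ∑ k : ↥S, (inner ℂ (c k) (c' k)).re)
      (fun c₁ c₂ c' => by
        simp only [Pi.add_apply, inner_add_left, Complex.add_re, Finset.sum_add_distrib])
      (fun a c c' => by
        simp only [Pi.smul_apply, hsmul, inner_smul_left, Complex.conj_ofReal,
          Complex.re_ofReal_mul, Finset.mul_sum, smul_eq_mul])
      (fun c c₁ c₂ => by
        simp only [Pi.add_apply, inner_add_right, Complex.add_re, Finset.sum_add_distrib])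
      (fun a c c' => by
        simp only [Pi.smul_apply, hsmul, inner_smul_right, Complex.re_ofReal_mul,
          Finset.mul_sum, smul_eq_mul]),
      fun _ _ => rfl⟩
  obtain ⟨B, hB_apply⟩ : ∃ B : Y →ₗ[ℝ] Y →ₗ[ℝ] ℝ, ∀ c c' : Y, B c c' =
      ∑ k : ↥S, (inner ℂ ((c : ↥S → EuclideanSpace ℂ d) k) ((c' : ↥S → EuclideanSpace ℂ d) k)).re :=
    ⟨B₀.compl₁₂ Y.subtype Y.subtype, fun c c' => hB₀ _ _⟩
  have hB_self : ∀ c : Y, B c c = ∑ k : ↥S, ‖(c : ↥S → EuclideanSpace ℂ d) k‖ ^ 2 := by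
    intro c
    rw [hB_apply]
    refine Finset.sum_congr rfl fun k _ => ?_
    rw [← RCLike.re_to_complex, inner_self_eq_norm_sq]
  have hB_pos : ∀ c : Y, c ≠ 0 → 0 < B c c := by
    intro c hc
    rw [hB_self]
    have hc' : (c : ↥S → EuclideanSpace ℂ d) ≠ 0 := fun h => hc (Subtype.ext h)
    obtain ⟨k, hk⟩ : ∃ k, (c : ↥S → EuclideanSpace ℂ d) k ≠ 0 := Function.ne_iff.1 hc'
    exact lt_of_lt_of_le (pow_pos (norm_pos_iff.2 hk) 2)
      (Finset.single_le_sum (f := fun k => ‖(c : ↥S → EuclideanSpace ℂ d) k‖ ^ 2)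
        (fun k _ => sq_nonneg _) (Finset.mem_univ k))
  -- the field `-V` on the invariant subspace
  obtain ⟨V, hVc, hV⟩ : ∃ V : Y → Y, Continuous V ∧
      ∀ c : Y, ((V c : Y) : ↥S → EuclideanSpace ℂ d) = -galerkinRHS S ν g c :=
    ⟨fun c => ⟨-galerkinRHS S ν g c, Y.neg_mem (hWinv c c.2)⟩,
      Continuous.subtype_mk
        ((continuous_galerkinRHS ν).comp (continuous_const.prodMk continuous_subtype_val)).neg _,
      fun c => rfl⟩
  -- coercivity
  obtain ⟨γ, hγ⟩ : ∃ γ : ℝ, γ = ∑ k : ↥S, ‖g k‖ ^ 2 := ⟨_, rfl⟩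
  have hγ0 : 0 ≤ γ := by rw [hγ]; exact Finset.sum_nonneg fun k _ => sq_nonneg _
  have hden : 0 < 4 * Real.pi ^ 2 * ν := by positivity
  have hcoer : ∀ c : Y, γ / (4 * Real.pi ^ 2 * ν) ^ 2 ≤ B c c → 0 ≤ B (V c) c := by
    intro c hrc
    have hcY : (c : ↥S → EuclideanSpace ℂ d) ∈ galerkinSubspace S := hWle c.2
    obtain ⟨b, hb⟩ : ∃ b : ℝ, b = ∑ k : ↥S, ‖(c : ↥S → EuclideanSpace ℂ d) k‖ ^ 2 := ⟨_, rfl⟩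
    have hb0 : 0 ≤ b := by rw [hb]; exact Finset.sum_nonneg fun k _ => sq_nonneg _
    rw [hB_self, ← hb] at hrc
    -- `B (V c) c = ν ‖∇u‖² - ∫ ⟪G, u⟫`
    have hVB : B (V c) c =
        ν * (eGradNormSq (realTrigPoly S (coeffExt S (c : ↥S → EuclideanSpace ℂ d)))).toReal -
          ∫ x, ⟪realTrigPoly S (coeffExt S g) x,
            realTrigPoly S (coeffExt S (c : ↥S → EuclideanSpace ℂ d)) x⟫_ℝ := by
      rw [hB_apply]
      have h1 : ∀ k : ↥S, (inner ℂ (((V c : Y) : ↥S → EuclideanSpace ℂ d) k)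
          ((c : ↥S → EuclideanSpace ℂ d) k)).re =
          -(inner ℂ ((c : ↥S → EuclideanSpace ℂ d) k) (galerkinRHS S ν g c k)).re := by
        intro k
        rw [← inner_conj_symm, Complex.conj_re, hV c, Pi.neg_apply, inner_neg_right, Complex.neg_re]
      simp only [h1, Finset.sum_neg_distrib, sum_re_inner_galerkinRHS_self ν hS hg hcY]
      ring
    rw [hVB, toReal_eGradNormSq_realTrigPoly hS (hcY.1.isConjSymm_coeffExt hS),
      sum_coeffExt (fun k v => freqNormSq k * ‖v‖ ^ 2)]
    have hpair := integral_inner_realTrigPoly_coeffExt_le hS hg hcY.1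
    rw [← hγ, ← hb] at hpair
    have hbE := sum_norm_sq_le_sum_freqNormSq_mul hS0 (c : ↥S → EuclideanSpace ℂ d)
    rw [← hb] at hbE
    -- `√γ √b ≤ 4π²ν b` since `γ/(4π²ν)² ≤ b`
    have h2 : γ ≤ (4 * Real.pi ^ 2 * ν) ^ 2 * b := by
      rw [div_le_iff₀ (by positivity)] at hrc
      linarith
    have h1 : Real.sqrt γ ≤ 4 * Real.pi ^ 2 * ν * Real.sqrt b := by
      calc Real.sqrt γ ≤ Real.sqrt ((4 * Real.pi ^ 2 * ν) ^ 2 * b) := Real.sqrt_le_sqrt h2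
        _ = 4 * Real.pi ^ 2 * ν * Real.sqrt b := by
          rw [Real.sqrt_mul (sq_nonneg _), Real.sqrt_sq hden.le]
    have hsqrt : Real.sqrt γ * Real.sqrt b ≤ ν * (4 * Real.pi ^ 2 * b) := by
      calc Real.sqrt γ * Real.sqrt b ≤ 4 * Real.pi ^ 2 * ν * Real.sqrt b * Real.sqrt b :=
            mul_le_mul_of_nonneg_right h1 (Real.sqrt_nonneg _)
        _ = ν * (4 * Real.pi ^ 2 * b) := by
            rw [mul_assoc, Real.mul_self_sqrt hb0]; ring
    have hE : ν * (4 * Real.pi ^ 2 * b) ≤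
        ν * (4 * Real.pi ^ 2 * ∑ k : ↥S, freqNormSq (k : d → ℤ) *
          ‖(c : ↥S → EuclideanSpace ℂ d) k‖ ^ 2) :=
      mul_le_mul_of_nonneg_left (mul_le_mul_of_nonneg_left hbE (by positivity)) hν.le
    linarith
  obtain ⟨c, hc⟩ :=
    Literature.Topology.Euclidean.Brouwer.exists_zero_of_bilin_coercive B hB_pos hVc hcoer
  refine ⟨c, c.2, ?_⟩
  have h := hV c
  rw [hc, Submodule.coe_zero] at h
  exact neg_eq_zero.1 h.symm

end Stationary

end MirrorSteadyExistence

end Summit.AnomalousDissipation.AnomalousDissipation.Theorems
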